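import Mathlib
import Summits.MatrixMultiplication.MatrixMultiplication.Theses.CwPowerHosting

/-!
# Line `self-affine-towers` — crux `CwPowerHosting.HostingRateThree` (stmt-MatrixMultiplication-15970)

Crux-strategist line (planner-cstrat-stmt-MatrixMultiplication-15970-b1-0, 2026-08-17).  Card: `Lines/self-affine-towers.md`.
Namespace `…Cruxes.HostingRateThree.SelfAffineTowers`.

THE DOOR (TRANSFER lens, `C⁺ ⟹ C`).  Every free hosting of `supp(xyz^{⊠N})` known to this seat — the Klein products
`(ℤ/2)^{2N}`, the exact rank-two family `(ℤ/2^N)²` (`p_j = 2^j e₂`, `q_j = 2^j e₁`), the cyclic families `ℤ/2^N(2^N+1)` and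
`ℤ/(4^N+2^N+1) = ℤ[ω]/(2^N − ω)` (digits `{0, 1, λ}·2^i`, `λ` a primitive sixth root of unity), the integer carry towers of
rates `5, 4.24, 4.16` (block sizes `1, 2, 3`) — is a SELF-AFFINE DIGIT TOWER: a finite block of `m` template pairs
`u_s, w_s ∈ ℤ^d` repeated at the scales `b^j`, `j < k`, read in a finite quotient of `ℤ^d`.  For such towers the hosting
axiom for ALL `k` is decided by ONE finite object (the block's value set plus its carry automaton: no carry path returns to
`0`), and the rate is `b^{d/m}` exactly.  `C⁺` = `stub_selfAffineCertificate`: for every `ε > 0` some block has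
`b^d ≤ 3^{(1+ε)m}` and a valid tower.  WHY EASIER: (i) one finite certificate yields hostings of every power (the crux asks
for one power per `ε`, with no structure to search); (ii) validity is a reachability question in a finite graph, so every
cell `(b, d, m, template box)` is a terminating computation (cells of rate `< 4` searched empty so far: `Lines/self-affine-towers.md`
§Cheapest falsifier, STRATEGY-CENSUS.md F5–F6); (iii) the class is closed under the operations that produced every record
(products = block sums, number-ring bases `β` = scalar base `N(β)^{L/2}` on a larger block, mixed radix = diagonal bases).
The other stubs are tools: `stub_boxCompression` (an integer tower with no zero-sum transversal stays transversal-free in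
the box quotient `(ℤ/M)^d`, `M = 2 S_k + 1 ≤ C·b^k`) and `stub_pairsGiveHosting` (= the route's support item
`PairsGiveHosting`, stmt-MatrixMultiplication-15977, by name).  `HostingRateThree_of` is kernel-checked below.

Disproof used: none exists yet for this crux (`Cruxes/HostingRateThree/` had no `Disproof.lean` at registration); the line
honours the route's own floors: its witnesses have unbounded exponent (`TwoGroupFloor`/`ThreeGroupFloor`/tricolored
barrier do not bite) and size `≥ 4·3^{N}`-ish only through the certificate's rate, never `3^N·O(1)` (ChainFloor kills
`b^d = 3^m` exactly: recorded as the first dead cell).  Negatives index (9 refuted statements of the summit): none is an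
instance.
-/

set_option linter.dupNamespace false
set_option linter.unusedVariables false

namespace Summit.MatrixMultiplication.MatrixMultiplication.Cruxes.HostingRateThree.SelfAffineTowers

open Finset
open Summit.MatrixMultiplication.MatrixMultiplication.Theses.CwPowerHosting (HostingRateThree PairsGiveHosting)

/-! ## Definitions -/

/-- The pair system `(p_i, q_i)_{i < N}` in an abelian group has NO ZERO-SUM TRANSVERSAL: no nonempty set of coordinates
carries values from the nine-element value sets `{±p_i, ±q_i, ±(p_i−q_i), −(p_i+q_i), 2p_i−q_i, 2q_i−p_i}` summing to
zero (the hypothesis of the route's `PairsGiveHosting`, verbatim). -/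
def NoZeroSumTransversal {H : Type} [AddCommGroup H] [DecidableEq H] {N : ℕ} (p q : Fin N → H) : Prop :=
  ∀ (D : Finset (Fin N)) (v : Fin N → H), D.Nonempty →
    (∀ i ∈ D, v i ∈ ({p i, -p i, q i, -q i, p i - q i, q i - p i, -(p i + q i), 2 • p i - q i, 2 • q i - p i} : Finset H)) →
    ∑ i ∈ D, v i ≠ 0

/-- The `k`-level TOWER of a block of `m` templates `u : Fin m → ℤ^d` at integer base `b`: coordinate `(j, s)` (level `j < k`,
template `s < m`, flattened to `Fin (k * m)` by `finProdFinEquiv`) carries `b^j • u s`. -/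
def tower (b : ℕ) {m d : ℕ} (u : Fin m → Fin d → ℤ) (k : ℕ) : Fin (k * m) → Fin d → ℤ :=
  fun i => ((b : ℤ) ^ ((finProdFinEquiv.symm i).1 : ℕ)) • u (finProdFinEquiv.symm i).2

/-- A block `(b; u, w)` is a VALID SELF-AFFINE TOWER if every finite tower built from it has no zero-sum transversal in
`ℤ^d` (decided in practice by the block's carry automaton; here stated as the property it certifies). -/
def TowerValid (b : ℕ) {m d : ℕ} (u w : Fin m → Fin d → ℤ) : Prop :=
  ∀ k : ℕ, NoZeroSumTransversal (tower b u k) (tower b w k)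

/-! ## Statements of the stubs as named `Prop`s (`Stmt.stub_*`) -/
namespace Stmt

/-- Statement of `stub_selfAffineCertificate` (HEART, open; the searchable form of the crux).  For every `ε > 0` there is a
valid self-affine tower block of rate `b^{d/m} ≤ 3^{1+ε}`: dimension `d ≥ 1`, block size `m ≥ 1`, base `b ≥ 2`, templates
`u w : Fin m → ℤ^d` with `b^d ≤ 3^{(1+ε) m}` and `TowerValid b u w`.  Why it might fail: every cell of rate `< 4` searched so
far is empty (integer towers `m ≤ 3`, binary towers `(d,m) = (5,3), (7,4)`, 2D bases of determinant `10–13`), and the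
conjectured 2-adic floor (every abelian 2-group hosting has `|H| ≥ 4^N`, checked through `N = 4`) would kill all cells with
`b` a power of two. -/
def stub_selfAffineCertificate : Prop :=
  ∀ ε : ℝ, 0 < ε → ∃ (d m b : ℕ) (u w : Fin m → Fin d → ℤ),
    1 ≤ d ∧ 1 ≤ m ∧ 2 ≤ b ∧ ((b : ℝ) ^ d) ≤ (3 : ℝ) ^ ((1 + ε) * m) ∧ TowerValid b u w

/-- Statement of `stub_boxCompression` (TOOL, provable now, S/M).  A valid integer tower stays transversal-free in a box
quotient of linear size: there is `C` (e.g. `C = 2·Σ_s (3‖u_s‖_∞ + 3‖w_s‖_∞) + 1`) such that for every `k` some modulus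
`1 ≤ M ≤ C·b^k` makes the reduction of the `k`-level tower to `(ℤ/M)^d` a pair system with no zero-sum transversal
(every transversal sum of the tower has sup-norm `≤ S_k < M/2`, so vanishing mod `M` forces vanishing in `ℤ^d`). -/
def stub_boxCompression : Prop :=
  ∀ (d m b : ℕ) (u w : Fin m → Fin d → ℤ), 2 ≤ b → TowerValid b u w →
    ∃ C : ℕ, ∀ k : ℕ, ∃ M : ℕ, 1 ≤ M ∧ (M : ℝ) ≤ C * (b : ℝ) ^ k ∧
      NoZeroSumTransversal (H := Fin d → ZMod M)
        (fun i j => ((tower b u k i j : ℤ) : ZMod M)) (fun i j => ((tower b w k i j : ℤ) : ZMod M))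

/-- Statement of `stub_pairsGiveHosting` (GLUE = route CwPowerHosting's support item `PairsGiveHosting`,
stmt-MatrixMultiplication-15977, provable now, by name). -/
def stub_pairsGiveHosting : Prop := PairsGiveHosting

end Stmt

/-! ## Registered stubs -/

/-- HEART (open): a self-affine digit tower of rate `≤ 3^{1+ε}` exists for every `ε > 0`, see
`Stmt.stub_selfAffineCertificate`. -/
theorem stub_selfAffineCertificate : Stmt.stub_selfAffineCertificate := by
  sorry

/-- TOOL (S/M): box compression of valid integer towers, see `Stmt.stub_boxCompression`. -/
theorem stub_boxCompression : Stmt.stub_boxCompression := by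
  sorry

/-- GLUE (provable now): the route's `PairsGiveHosting`, see `Stmt.stub_pairsGiveHosting`. -/
theorem stub_pairsGiveHosting : Stmt.stub_pairsGiveHosting := by
  sorry

/-! ## Composition (kernel-checked, no sorry) -/

/-- Heart + compression + pairs-give-hosting ⇒ the crux BY NAME.  Bookkeeping: take the certificate at `ε/2`
(`b^d ≤ 3^{(1+ε/2)m}`), the compression constant `C`, and `k` so large that `C^d ≤ 3^{(ε/2) m k}`
(`pow_unbounded_of_one_lt`); then `N = k·m ≥ 1`, `H = (ℤ/M)^d`, `|H| = M^d ≤ C^d (b^d)^k ≤ 3^{(1+ε) N}`. -/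
theorem HostingRateThree_of :
    Stmt.stub_selfAffineCertificate → Stmt.stub_boxCompression → Stmt.stub_pairsGiveHosting → HostingRateThree := by
  intro hC hB hP ε hε
  obtain ⟨d, m, b, u, w, hd, hm, hb, hrate, hvalid⟩ := hC (ε / 2) (by positivity)
  obtain ⟨C, hCk⟩ := hB d m b u w hb hvalid
  -- the growth factor `g = 3^{(ε/2) m} > 1`
  set g : ℝ := (3 : ℝ) ^ (ε / 2 * m) with hg
  have hm0 : (0 : ℝ) < m := by exact_mod_cast hm
  have hg1 : 1 < g := by
    rw [hg]
    exact Real.one_lt_rpow (by norm_num) (by positivity)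
  obtain ⟨k₀, hk₀⟩ := pow_unbounded_of_one_lt ((C : ℝ) ^ d) hg1
  set k : ℕ := k₀ + 1 with hk
  have hk1 : 1 ≤ k := by omega
  have hCd : (C : ℝ) ^ d ≤ g ^ k := by
    refine hk₀.le.trans ?_
    exact pow_le_pow_right₀ hg1.le (by omega)
  obtain ⟨M, hM1, hMle, hNZ⟩ := hCk k
  haveI : NeZero M := ⟨by omega⟩
  -- the hosting in `H = (ℤ/M)^d`
  obtain ⟨α, β, γ, hhost⟩ := hP (k * m) (Fin d → ZMod M) _ _ hNZ
  refine ⟨k * m, Fin d → ZMod M, inferInstance, inferInstance, ?_, ?_, α, β, γ, hhost⟩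
  · exact Nat.one_le_iff_ne_zero.mpr (Nat.mul_ne_zero (by omega) (by omega))
  · -- |H| = M^d ≤ (C b^k)^d = C^d (b^d)^k ≤ g^k (3^{(1+ε/2)m})^k = 3^{(1+ε) m k}
    have hcard : (Fintype.card (Fin d → ZMod M) : ℝ) = (M : ℝ) ^ d := by
      rw [Fintype.card_fun, ZMod.card, Fintype.card_fin]; push_cast; ring
    rw [hcard]
    have hM0 : (0 : ℝ) ≤ (M : ℝ) := by positivity
    have hb0 : (0 : ℝ) ≤ (b : ℝ) := by positivity
    have h1 : (M : ℝ) ^ d ≤ ((C : ℝ) * (b : ℝ) ^ k) ^ d := pow_le_pow_left₀ hM0 hMle d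
    have h2 : ((C : ℝ) * (b : ℝ) ^ k) ^ d = (C : ℝ) ^ d * ((b : ℝ) ^ d) ^ k := by
      rw [mul_pow, ← pow_mul, ← pow_mul, mul_comm k d]
    have h3 : ((b : ℝ) ^ d) ^ k ≤ ((3 : ℝ) ^ ((1 + ε / 2) * m)) ^ k :=
      pow_le_pow_left₀ (by positivity) hrate k
    have h4 : (C : ℝ) ^ d * ((b : ℝ) ^ d) ^ k ≤ g ^ k * ((3 : ℝ) ^ ((1 + ε / 2) * m)) ^ k :=
      mul_le_mul hCd h3 (by positivity) (by positivity)
    have h5 : g ^ k * ((3 : ℝ) ^ ((1 + ε / 2) * m)) ^ k = (3 : ℝ) ^ ((1 + ε) * ((k * m : ℕ) : ℝ)) := by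
      rw [hg, ← Real.rpow_natCast ((3 : ℝ) ^ (ε / 2 * m)) k, ← Real.rpow_natCast ((3 : ℝ) ^ ((1 + ε / 2) * m)) k,
        ← Real.rpow_mul (by norm_num), ← Real.rpow_mul (by norm_num), ← Real.rpow_add (by norm_num)]
      push_cast
      ring_nf
    calc (M : ℝ) ^ d ≤ ((C : ℝ) * (b : ℝ) ^ k) ^ d := h1
      _ = (C : ℝ) ^ d * ((b : ℝ) ^ d) ^ k := h2
      _ ≤ g ^ k * ((3 : ℝ) ^ ((1 + ε / 2) * m)) ^ k := h4
      _ = (3 : ℝ) ^ ((1 + ε) * ((k * m : ℕ) : ℝ)) := h5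

/-- The crux modulo the registered stubs. -/
theorem HostingRateThree_proof : HostingRateThree :=
  HostingRateThree_of stub_selfAffineCertificate stub_boxCompression stub_pairsGiveHosting

/-! ## Sanity: the definitions compute (the Klein hosting `N = 1`, i.e. the cell `b = 2, d = 2, m = 1` at one level) -/

/-- The one-level tower of the block `u = e₂`, `w = e₁` in `ℤ²` is the pair `((0,1), (1,0))` (definitional unfolding check). -/
example : tower 2 (m := 1) (d := 2) (fun _ => ![0, 1]) 1 ⟨0, by norm_num⟩ = ![0, 1] := by
  simp [tower]

end Summit.MatrixMultiplication.MatrixMultiplication.Cruxes.HostingRateThree.SelfAffineTowers
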